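import Mathlib

/-!
# PfPersistenceF2PlantedIndex — a planted zero quadruple adds at most ONE negative eigenvalue per parity sector

Pure linear algebra behind FAKES.md §2.1 COROLLARY P2-INDEX (pub-rhpf-fake-2; mechanism/rigidity
campaign, no RH claims).  In the A3 normalisation the planted quadruple `{½ ± η ± iḡ}` of weight `w`
changes the even Galerkin block by `ΔQ = c • (p pᵀ − q qᵀ)` and the odd block by
`ΔQ = −c • (p̃ p̃ᵀ − q̃ q̃ᵀ)`, `c = 4w ≥ 0`, `p + iq = (u_n(η + iḡ))_n`.  If the unperturbed block `A`
(ζ's block at the same window) is positive semidefinite, then `A + ΔQ` is nonnegative on a nonzero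
vector of EVERY subspace of dimension ≥ 2 — the Courant–Fischer form of "the second-smallest
eigenvalue is ≥ 0", i.e. at most one negative eigenvalue per sector per planted quadruple.
We prove the min–max form directly (theorems `planted_minmax_even`, `planted_minmax_odd`).
-/


namespace Summit.RiemannHypothesis.RiemannHypothesis.Theorems.PfPersistenceF2PlantedIndex

open Matrix BigOperators

variable {n : Type*} [Fintype n]

/-- `vecMulVec a b *ᵥ v = (b ⬝ᵥ v) • a`. -/
theorem vecMulVec_mulVec_eq (a b v : n → ℝ) :
    vecMulVec a b *ᵥ v = (b ⬝ᵥ v) • a := by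
  ext i
  simp [Matrix.mulVec, Matrix.vecMulVec, dotProduct, Finset.mul_sum, mul_comm, mul_left_comm]

/-- Quadratic form of the planted rank-two block. -/
theorem dotProduct_planted_mulVec (p q v : n → ℝ) (c : ℝ) :
    v ⬝ᵥ ((c • (vecMulVec p p - vecMulVec q q)) *ᵥ v)
      = c * (p ⬝ᵥ v) ^ 2 - c * (q ⬝ᵥ v) ^ 2 := by
  rw [Matrix.smul_mulVec, sub_mulVec, vecMulVec_mulVec_eq, vecMulVec_mulVec_eq, dotProduct_smul,
    dotProduct_sub, dotProduct_smul, dotProduct_smul, dotProduct_comm v p, dotProduct_comm v q]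
  simp only [smul_eq_mul]
  ring

/-- In every subspace of dimension ≥ 2 there is a nonzero vector orthogonal to a given `q`. -/
theorem exists_mem_ne_zero_dotProduct_eq_zero (V : Submodule ℝ (n → ℝ))
    (hV : 2 ≤ Module.finrank ℝ V) (q : n → ℝ) :
    ∃ v ∈ V, v ≠ 0 ∧ q ⬝ᵥ v = 0 := by
  classical
  let φ : V →ₗ[ℝ] ℝ :=
    { toFun := fun v => q ⬝ᵥ (v : n → ℝ)
      map_add' := by intro x y; simp [dotProduct_add]
      map_smul' := by intro r x; simp [dotProduct_smul] }
  have hrange : Module.finrank ℝ (LinearMap.range φ) ≤ 1 := by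
    calc Module.finrank ℝ (LinearMap.range φ) ≤ Module.finrank ℝ ℝ := Submodule.finrank_le _
      _ = 1 := Module.finrank_self ℝ
  have hsum := LinearMap.finrank_range_add_finrank_ker φ
  have hker : 0 < Module.finrank ℝ (LinearMap.ker φ) := by omega
  have hne : LinearMap.ker φ ≠ ⊥ := by
    intro h
    rw [h, finrank_bot] at hker
    exact lt_irrefl _ hker
  obtain ⟨y, hyk, hy0⟩ := (Submodule.ne_bot_iff _).1 hne
  refine ⟨(y : n → ℝ), y.2, ?_, ?_⟩
  · intro h
    apply hy0
    apply Subtype.ext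
    simpa using h
  · have hk : φ y = 0 := LinearMap.mem_ker.1 hyk
    simpa [φ] using hk

/-- **P2-INDEX, even sector.**  `A` PSD, `c ≥ 0`: `A + c (p pᵀ − q qᵀ)` is nonnegative on some nonzero
vector of every subspace of dimension ≥ 2 (second min–max value ≥ 0: at most one negative eigenvalue). -/
theorem planted_minmax_even (A : Matrix n n ℝ) (hA : A.PosSemidef) (p q : n → ℝ) {c : ℝ}
    (hc : 0 ≤ c) (V : Submodule ℝ (n → ℝ)) (hV : 2 ≤ Module.finrank ℝ V) :
    ∃ v ∈ V, v ≠ 0 ∧ 0 ≤ v ⬝ᵥ ((A + c • (vecMulVec p p - vecMulVec q q)) *ᵥ v) := by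
  obtain ⟨v, hvV, hv0, hqv⟩ := exists_mem_ne_zero_dotProduct_eq_zero V hV q
  refine ⟨v, hvV, hv0, ?_⟩
  rw [add_mulVec, dotProduct_add, dotProduct_planted_mulVec, hqv]
  have h1 : 0 ≤ v ⬝ᵥ (A *ᵥ v) := by
    simpa using hA.dotProduct_mulVec_nonneg v
  have h2 : 0 ≤ c * (p ⬝ᵥ v) ^ 2 := mul_nonneg hc (sq_nonneg _)
  have h3 : c * (0 : ℝ) ^ 2 = 0 := by ring
  linarith

/-- **P2-INDEX, odd sector.**  Same with the sign of the planted block reversed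
(`ΔQ_odd = −c (p̃ p̃ᵀ − q̃ q̃ᵀ)`): choose the vector orthogonal to `p̃` instead. -/
theorem planted_minmax_odd (A : Matrix n n ℝ) (hA : A.PosSemidef) (p q : n → ℝ) {c : ℝ}
    (hc : 0 ≤ c) (V : Submodule ℝ (n → ℝ)) (hV : 2 ≤ Module.finrank ℝ V) :
    ∃ v ∈ V, v ≠ 0 ∧ 0 ≤ v ⬝ᵥ ((A - c • (vecMulVec p p - vecMulVec q q)) *ᵥ v) := by
  obtain ⟨v, hvV, hv0, hpv⟩ := exists_mem_ne_zero_dotProduct_eq_zero V hV p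
  refine ⟨v, hvV, hv0, ?_⟩
  rw [sub_mulVec, dotProduct_sub, dotProduct_planted_mulVec, hpv]
  have h1 : 0 ≤ v ⬝ᵥ (A *ᵥ v) := by
    simpa using hA.dotProduct_mulVec_nonneg v
  have h2 : 0 ≤ c * (q ⬝ᵥ v) ^ 2 := mul_nonneg hc (sq_nonneg _)
  have h3 : c * (0 : ℝ) ^ 2 = 0 := by ring
  linarith

/-- Several planted quadruples: `m` of them add at most `m` negative eigenvalues — min–max form:
`A + Σ_{j<m} c_j (p_j p_jᵀ − q_j q_jᵀ)` (all `c_j ≥ 0`) is nonnegative on a nonzero vector of every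
subspace of dimension ≥ m + 1.  (Induction on `m`, peeling one `q_j`-orthogonality at a time.) -/
theorem planted_minmax_sum (A : Matrix n n ℝ) (hA : A.PosSemidef) (m : ℕ)
    (p q : Fin m → n → ℝ) (c : Fin m → ℝ) (hc : ∀ j, 0 ≤ c j)
    (V : Submodule ℝ (n → ℝ)) (hV : m + 1 ≤ Module.finrank ℝ V) :
    ∃ v ∈ V, v ≠ 0 ∧
      0 ≤ v ⬝ᵥ ((A + ∑ j, c j • (vecMulVec (p j) (p j) - vecMulVec (q j) (q j))) *ᵥ v) := by
  classical
  -- the subspace of V orthogonal to all q_j has dimension ≥ finrank V − m ≥ 1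
  let φ : V →ₗ[ℝ] (Fin m → ℝ) :=
    { toFun := fun v j => q j ⬝ᵥ (v : n → ℝ)
      map_add' := by intro x y; ext j; simp [dotProduct_add]
      map_smul' := by intro r x; ext j; simp [dotProduct_smul] }
  have hrange : Module.finrank ℝ (LinearMap.range φ) ≤ m := by
    calc Module.finrank ℝ (LinearMap.range φ) ≤ Module.finrank ℝ (Fin m → ℝ) := Submodule.finrank_le _
      _ = m := by simp
  have hsum := LinearMap.finrank_range_add_finrank_ker φ
  have hker : 0 < Module.finrank ℝ (LinearMap.ker φ) := by omega
  have hne : LinearMap.ker φ ≠ ⊥ := by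
    intro h
    rw [h, finrank_bot] at hker
    exact lt_irrefl _ hker
  obtain ⟨y, hyk, hy0⟩ := (Submodule.ne_bot_iff _).1 hne
  refine ⟨(y : n → ℝ), y.2, ?_, ?_⟩
  · intro h
    apply hy0
    apply Subtype.ext
    simpa using h
  · have hk : φ y = 0 := LinearMap.mem_ker.1 hyk
    have hq : ∀ j, q j ⬝ᵥ (y : n → ℝ) = 0 := by
      intro j
      have := congrArg (fun f => f j) hk
      simpa [φ] using this
    set v : n → ℝ := (y : n → ℝ) with hvdef
    rw [add_mulVec, dotProduct_add, Matrix.sum_mulVec, dotProduct_sum]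
    have h1 : 0 ≤ v ⬝ᵥ (A *ᵥ v) := by
      simpa using hA.dotProduct_mulVec_nonneg v
    have h2 : ∀ j, 0 ≤ v ⬝ᵥ ((c j • (vecMulVec (p j) (p j) - vecMulVec (q j) (q j))) *ᵥ v) := by
      intro j
      rw [dotProduct_planted_mulVec, hq j]
      have : 0 ≤ c j * (p j ⬝ᵥ v) ^ 2 := mul_nonneg (hc j) (sq_nonneg _)
      have h3 : c j * (0 : ℝ) ^ 2 = 0 := by ring
      linarith
    have h4 : 0 ≤ ∑ j, v ⬝ᵥ ((c j • (vecMulVec (p j) (p j) - vecMulVec (q j) (q j))) *ᵥ v) :=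
      Finset.sum_nonneg fun j _ => h2 j
    linarith

end Summit.RiemannHypothesis.RiemannHypothesis.Theorems.PfPersistenceF2PlantedIndex

#print axioms Summit.RiemannHypothesis.RiemannHypothesis.Theorems.PfPersistenceF2PlantedIndex.planted_minmax_even
#print axioms Summit.RiemannHypothesis.RiemannHypothesis.Theorems.PfPersistenceF2PlantedIndex.planted_minmax_odd
#print axioms Summit.RiemannHypothesis.RiemannHypothesis.Theorems.PfPersistenceF2PlantedIndex.planted_minmax_sum
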